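import Mathlib
import HarnessLib

/-!
# `AffineBernoulli.AlignedStratumTrivial` — test functions I: smooth cutoffs of a set with
  gradient `O(1/ε)` and the cutoff error estimate
  (route `AffineBernoulli`, item stmt-NavierStokesRegularity-13663, helper file III)

Generic real analysis on `ℝ³ = EuclideanSpace ℝ (Fin 3)` (no fluid mechanics):

* `AlignedStratum.exists_cutoff` — for a set `K` there is `M ≥ 0` such that for every `ε > 0`
  there is a `C¹` function `η : ℝ³ → [0,1]` vanishing on the `3ε/4`-neighbourhood of `K`, equal to
  `1` at distance `≥ 3ε` from `K`, with `‖Dη‖ ≤ M/ε` everywhere and `Dη = 0` off the annulus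
  `{ε/2 < dist(·,K) < 4ε}`. Construction: mollify the `1`-Lipschitz function `infDist · K` with a
  normed bump of radius `ε/4` (smooth, still `1`-Lipschitz, within `ε/4` of `infDist`) and compose
  with `Real.smoothTransition`.
* `AlignedStratum.abs_integral_cutoff_error_le` — if `|g| ≤ 1`, `g = 0` off `closedBall c R` and
  `‖G y‖ ≤ A · infDist y K` on that ball, then `|∫ g · Dη[G]| ≤ 4 M A · vol(S_ε)` with
  `S_ε = {y ∈ closedBall c R | 0 < infDist y K < 4ε}`;
  `AlignedStratum.exists_volume_annulus_le` — `vol(S_ε) → 0` as `ε → 0⁺`.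

HONEST FRAMING: calculus lemmas serving a Liouville lemma about HYPOTHETICAL self-similar Euler
profiles; nothing here bears on the regularity problem itself.
-/

noncomputable section

set_option linter.dupNamespace false

namespace Summit.NavierStokesRegularity.NavierStokesRegularity.Theorems

open Set Function Filter Topology InnerProductSpace MeasureTheory Metric
open scoped RealInnerProductSpace

namespace AlignedStratum

/-! ### A bounded-derivative transition function -/

/-- Off `[0,1]` the transition function is locally constant, so its derivative vanishes. -/
theorem fderiv_smoothTransition_eq_zero {s : ℝ} (hs : s ∉ Icc (0 : ℝ) 1) :
    fderiv ℝ Real.smoothTransition s = 0 := by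
  rw [mem_Icc, not_and_or, not_le, not_le] at hs
  rcases hs with hs | hs
  · have hev : (Real.smoothTransition : ℝ → ℝ) =ᶠ[𝓝 s] fun _ => (0 : ℝ) := by
      filter_upwards [Iio_mem_nhds hs] with t ht
      exact Real.smoothTransition.zero_of_nonpos (le_of_lt ht)
    rw [hev.fderiv_eq, fderiv_const_apply]
  · have hev : (Real.smoothTransition : ℝ → ℝ) =ᶠ[𝓝 s] fun _ => (1 : ℝ) := by
      filter_upwards [Ioi_mem_nhds hs] with t ht
      exact Real.smoothTransition.one_of_one_le (le_of_lt ht)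
    rw [hev.fderiv_eq, fderiv_const_apply]

/-- `Real.smoothTransition` has a bounded derivative: `‖D smoothTransition (s)‖ ≤ M` for all `s`,
for some `M ≥ 0` (the derivative is continuous and vanishes off `[0,1]`). -/
theorem exists_bound_fderiv_smoothTransition :
    ∃ M : ℝ, 0 ≤ M ∧ ∀ s : ℝ, ‖fderiv ℝ Real.smoothTransition s‖ ≤ M := by
  have hc : Continuous (fderiv ℝ Real.smoothTransition) :=
    (Real.smoothTransition.contDiff (n := 1)).continuous_fderiv one_ne_zero
  obtain ⟨M, hM⟩ := (isCompact_Icc (a := (0 : ℝ)) (b := 1)).exists_bound_of_continuousOn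
    hc.continuousOn
  refine ⟨max M 0, le_max_right _ _, fun s => ?_⟩
  by_cases hs : s ∈ Icc (0 : ℝ) 1
  · exact (hM s hs).trans (le_max_left _ _)
  · rw [fderiv_smoothTransition_eq_zero hs, norm_zero]
    exact le_max_right _ _

/-! ### Mollified distance function -/

/-- **Mollified distance.** For a set `K ⊆ ℝ³` and `r > 0` there is a smooth `d̃ : ℝ³ → ℝ` with
`|d̃ y − infDist y K| ≤ r` and `‖D d̃‖ ≤ 1` everywhere (convolution of the `1`-Lipschitz function
`infDist · K` with a normed bump of outer radius `r`). -/
theorem exists_smooth_infDist_approx (K : Set (EuclideanSpace ℝ (Fin 3))) {r : ℝ} (hr : 0 < r) :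
    ∃ d : EuclideanSpace ℝ (Fin 3) → ℝ, ContDiff ℝ 1 d ∧
      (∀ y, |d y - infDist y K| ≤ r) ∧ ∀ y, ‖fderiv ℝ d y‖ ≤ 1 := by
  set φ : ContDiffBump (0 : EuclideanSpace ℝ (Fin 3)) := ⟨r / 2, r, half_pos hr, half_lt_self hr⟩
    with hφ
  set f : EuclideanSpace ℝ (Fin 3) → ℝ := fun y => infDist y K with hf
  have hfl : LipschitzWith 1 f := lipschitz_infDist_pt (s := K)
  have hfc : Continuous f := hfl.continuous
  set d : EuclideanSpace ℝ (Fin 3) → ℝ :=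
    MeasureTheory.convolution (φ.normed volume) f (ContinuousLinearMap.lsmul ℝ ℝ) volume with hd
  have hsmooth : ContDiff ℝ 1 d :=
    φ.hasCompactSupport_normed.contDiff_convolution_left _ (φ.contDiff_normed (n := 1))
      (hfc.locallyIntegrable (μ := volume))
  refine ⟨d, hsmooth, fun y => ?_, fun y => ?_⟩
  · have h := φ.dist_normed_convolution_le (μ := volume) (x₀ := y) (ε := r)
      hfc.aestronglyMeasurable (fun x hx => ?_)
    · rwa [Real.dist_eq] at h
    · rw [Real.dist_eq]
      have := hfl.dist_le_mul x y
      rw [Real.dist_eq, NNReal.coe_one, one_mul] at this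
      exact this.trans (le_of_lt (mem_ball.1 hx))
  · -- `d` is `1`-Lipschitz as an average of translates of a `1`-Lipschitz function
    have hlip : LipschitzWith 1 d := by
      refine LipschitzWith.of_dist_le_mul fun x x' => ?_
      rw [NNReal.coe_one, one_mul, Real.dist_eq]
      have hint : ∀ z : EuclideanSpace ℝ (Fin 3),
          Integrable (fun t => φ.normed volume t * f (z - t)) volume := fun z =>
        (φ.continuous_normed.mul (hfc.comp (continuous_const.sub continuous_id)))
          |>.integrable_of_hasCompactSupport (φ.hasCompactSupport_normed.mul_right)
      have hx : d x = ∫ t, φ.normed volume t * f (x - t) := by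
        rw [hd, convolution_lsmul]; rfl
      have hx' : d x' = ∫ t, φ.normed volume t * f (x' - t) := by
        rw [hd, convolution_lsmul]; rfl
      rw [hx, hx', ← integral_sub (hint x) (hint x')]
      calc |∫ t, (φ.normed volume t * f (x - t) - φ.normed volume t * f (x' - t))|
          = ‖∫ t, φ.normed volume t * (f (x - t) - f (x' - t))‖ := by
            rw [Real.norm_eq_abs]; congr 1
            refine integral_congr_ae (Eventually.of_forall fun t => ?_); ring
        _ ≤ ∫ t, φ.normed volume t * dist x x' := by
            refine norm_integral_le_of_norm_le (φ.integrable_normed.mul_const _)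
              (Eventually.of_forall fun t => ?_)
            rw [norm_mul, Real.norm_eq_abs, abs_of_nonneg (φ.nonneg_normed t), Real.norm_eq_abs]
            refine mul_le_mul_of_nonneg_left ?_ (φ.nonneg_normed t)
            have := hfl.dist_le_mul (x - t) (x' - t)
            rw [NNReal.coe_one, one_mul, Real.dist_eq] at this
            refine this.trans ?_
            rw [dist_eq_norm, dist_eq_norm]; simp
        _ = dist x x' := by rw [integral_mul_const, φ.integral_normed, one_mul]
    simpa using norm_fderiv_le_of_lipschitz ℝ hlip (x₀ := y)

/-! ### The cutoff family of a set -/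

/-- **Smooth cutoffs of a set with gradient `O(1/ε)`.** For `K ⊆ ℝ³` there is `M ≥ 0` such
that for every `ε > 0` there is a `C¹` function `η : ℝ³ → [0,1]` with: `η y ≠ 0` only at distance
`> 3ε/4` from every point of `K`; `η y = 1` whenever `y` is at distance `≥ 3ε` from every point of
`K`; `‖Dη(y)‖ ≤ M/ε`; and `Dη(y) ≠ 0` only if some point of `K` is within `4ε` of `y` and all
points of `K` are at distance `> ε/2`. (For `K = ∅` take `η ≡ 1`.) -/
theorem exists_cutoff (K : Set (EuclideanSpace ℝ (Fin 3))) :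
    ∃ M : ℝ, 0 ≤ M ∧ ∀ ε : ℝ, 0 < ε → ∃ η : EuclideanSpace ℝ (Fin 3) → ℝ, ContDiff ℝ 1 η ∧
      (∀ y, 0 ≤ η y ∧ η y ≤ 1) ∧
      (∀ y, η y ≠ 0 → ∀ k ∈ K, 3 * ε / 4 < dist y k) ∧
      (∀ y, (∀ k ∈ K, 3 * ε ≤ dist y k) → η y = 1) ∧
      (∀ y, ‖fderiv ℝ η y‖ ≤ M / ε) ∧
      (∀ y, fderiv ℝ η y ≠ 0 → (∃ k ∈ K, dist y k < 4 * ε) ∧ ∀ k ∈ K, ε / 2 < dist y k) := by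
  obtain ⟨M, hM0, hM⟩ := exists_bound_fderiv_smoothTransition
  refine ⟨M, hM0, fun ε hε => ?_⟩
  rcases K.eq_empty_or_nonempty with hK | hK
  · refine ⟨fun _ => 1, contDiff_const, fun _ => ⟨zero_le_one, le_rfl⟩, ?_, fun _ _ => rfl, ?_, ?_⟩
    · intro y _ k hk; rw [hK] at hk; exact absurd hk (notMem_empty k)
    · intro y; rw [fderiv_const_apply, norm_zero]; positivity
    · intro y hy; rw [fderiv_const_apply] at hy; exact absurd rfl hy
  obtain ⟨d, hd1, hdist, hdD⟩ := exists_smooth_infDist_approx K (r := ε / 4) (by positivity)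
  set a : EuclideanSpace ℝ (Fin 3) → ℝ := fun y => ε⁻¹ * (d y - ε) with ha
  set η : EuclideanSpace ℝ (Fin 3) → ℝ := fun y => Real.smoothTransition (a y) with hη
  have hdd : Differentiable ℝ d := hd1.differentiable one_ne_zero
  have ha1 : ContDiff ℝ 1 a := contDiff_const.mul (hd1.sub contDiff_const)
  have haD : ∀ y, HasFDerivAt a (ε⁻¹ • fderiv ℝ d y) y := fun y => by
    have := ((hdd y).hasFDerivAt.sub_const ε).const_mul ε⁻¹
    simpa using this
  have hθD : ∀ y, HasFDerivAt η
      ((fderiv ℝ Real.smoothTransition (a y)).comp (ε⁻¹ • fderiv ℝ d y)) y := fun y =>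
    ((Real.smoothTransition.contDiff (n := 1)).differentiable one_ne_zero (a y)).hasFDerivAt.comp
      y (haD y)
  -- distance bookkeeping: `|d y − infDist y K| ≤ ε/4`
  have hlo : ∀ y, infDist y K - ε / 4 ≤ d y := fun y => by
    have := hdist y; rw [abs_le] at this; linarith
  have hhi : ∀ y, d y ≤ infDist y K + ε / 4 := fun y => by
    have := hdist y; rw [abs_le] at this; linarith
  refine ⟨η, Real.smoothTransition.contDiff.comp ha1, fun y =>
    ⟨Real.smoothTransition.nonneg _, Real.smoothTransition.le_one _⟩, ?_, ?_, ?_, ?_⟩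
  · -- support: `η y ≠ 0 ⇒ a y > 0 ⇒ d y > ε ⇒ infDist > 3ε/4`
    intro y hy k hk
    have hpos : 0 < a y := by
      by_contra h
      exact hy (Real.smoothTransition.zero_of_nonpos (not_lt.1 h))
    have hdy : ε < d y := by
      have : 0 < ε⁻¹ * (d y - ε) := hpos
      have h2 : 0 < d y - ε := by
        by_contra h
        exact absurd this (not_lt.2 (mul_nonpos_of_nonneg_of_nonpos (by positivity) (not_lt.1 h)))
      linarith
    have := infDist_le_dist_of_mem (x := y) hk
    linarith [hhi y]
  · -- `η = 1` far from `K`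
    intro y hy
    have hin : 3 * ε ≤ infDist y K := (le_infDist hK).2 fun k hk => hy k hk
    apply Real.smoothTransition.one_of_one_le
    show 1 ≤ ε⁻¹ * (d y - ε)
    rw [le_inv_mul_iff₀ hε]
    linarith [hlo y]
  · -- gradient bound
    intro y
    rw [(hθD y).fderiv]
    refine (ContinuousLinearMap.opNorm_comp_le _ _).trans ?_
    rw [norm_smul, norm_inv, Real.norm_eq_abs, abs_of_pos hε, div_eq_mul_inv]
    calc ‖fderiv ℝ Real.smoothTransition (a y)‖ * (ε⁻¹ * ‖fderiv ℝ d y‖)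
        ≤ M * (ε⁻¹ * 1) := by
          refine mul_le_mul (hM _) ?_ (by positivity) hM0
          exact mul_le_mul_of_nonneg_left (hdD y) (by positivity)
      _ = M * ε⁻¹ := by ring
  · -- where the gradient lives: `a y ∈ [0,1]`, i.e. `ε ≤ d y ≤ 2ε`
    intro y hy
    rw [(hθD y).fderiv] at hy
    have hay : a y ∈ Icc (0 : ℝ) 1 := by
      by_contra h
      exact hy (by rw [fderiv_smoothTransition_eq_zero h, ContinuousLinearMap.zero_comp])
    have h1 : ε ≤ d y := by
      have := hay.1; rw [ha] at this
      have : 0 ≤ d y - ε := by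
        by_contra h
        exact absurd this (not_le.2 (mul_neg_of_pos_of_neg (by positivity) (not_le.1 h)))
      linarith
    have h2 : d y ≤ 2 * ε := by
      have := hay.2
      have : ε⁻¹ * (d y - ε) ≤ 1 := this
      rw [inv_mul_le_iff₀ hε] at this
      linarith
    have hinlo : 3 * ε / 4 ≤ infDist y K := by linarith [hhi y]
    have hinhi : infDist y K < 4 * ε := by linarith [hlo y]
    refine ⟨(infDist_lt_iff hK).1 hinhi, fun k hk => ?_⟩
    have := infDist_le_dist_of_mem (x := y) hk
    linarith

/-! ### The cutoff error term -/

/-- The thin annular region around `K` (inside `closedBall c R`) that carries the gradient of the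
cutoff `η_ε`: `S_ε = {y | dist y c ≤ R, 0 < infDist y K < 4ε}`. It is measurable. -/
theorem measurableSet_annulus (K : Set (EuclideanSpace ℝ (Fin 3))) (c : EuclideanSpace ℝ (Fin 3))
    (R ε : ℝ) :
    MeasurableSet {y : EuclideanSpace ℝ (Fin 3) |
      dist y c ≤ R ∧ 0 < infDist y K ∧ infDist y K < 4 * ε} := by
  have h1 : MeasurableSet {y : EuclideanSpace ℝ (Fin 3) | dist y c ≤ R} :=
    measurableSet_le (by fun_prop) (by fun_prop)
  have h2 : MeasurableSet {y : EuclideanSpace ℝ (Fin 3) | 0 < infDist y K} :=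
    measurableSet_lt (by fun_prop) (continuous_infDist_pt K).measurable
  have h3 : MeasurableSet {y : EuclideanSpace ℝ (Fin 3) | infDist y K < 4 * ε} :=
    measurableSet_lt (continuous_infDist_pt K).measurable (by fun_prop)
  exact h1.inter (h2.inter h3)

/-- The annular region has finite volume (it lies in a closed ball). -/
theorem volume_annulus_lt_top (K : Set (EuclideanSpace ℝ (Fin 3))) (c : EuclideanSpace ℝ (Fin 3))
    (R ε : ℝ) :
    volume {y : EuclideanSpace ℝ (Fin 3) |
      dist y c ≤ R ∧ 0 < infDist y K ∧ infDist y K < 4 * ε} < ⊤ :=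
  lt_of_le_of_lt (measure_mono fun _ hy => mem_closedBall.2 hy.1) measure_closedBall_lt_top

/-- **Cutoff error estimate.** If `|g| ≤ 1`, `g` vanishes off `closedBall c R`, `‖G y‖ ≤ A·infDist y K`
on that ball, `‖Dη‖ ≤ M/ε` and `Dη(y) ≠ 0` only where some point of `K` is within `4ε` and all are
beyond `ε/2`, then `|∫ g · Dη[G]| ≤ 4 M A · vol(S_ε)`. -/
theorem abs_integral_cutoff_error_le {G : EuclideanSpace ℝ (Fin 3) → EuclideanSpace ℝ (Fin 3)}
    {g η : EuclideanSpace ℝ (Fin 3) → ℝ} {K : Set (EuclideanSpace ℝ (Fin 3))}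
    {c : EuclideanSpace ℝ (Fin 3)} {R A M ε : ℝ} (hε : 0 < ε) (hM : 0 ≤ M) (hA : 0 ≤ A)
    (hg1 : ∀ y, |g y| ≤ 1) (hgR : ∀ y, R < dist y c → g y = 0)
    (hGA : ∀ y, dist y c ≤ R → ‖G y‖ ≤ A * infDist y K)
    (h5 : ∀ y, ‖fderiv ℝ η y‖ ≤ M / ε)
    (h6 : ∀ y, fderiv ℝ η y ≠ 0 → (∃ k ∈ K, dist y k < 4 * ε) ∧ ∀ k ∈ K, ε / 2 < dist y k) :
    |∫ y, g y * fderiv ℝ η y (G y)| ≤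
      4 * M * A * (volume {y : EuclideanSpace ℝ (Fin 3) |
        dist y c ≤ R ∧ 0 < infDist y K ∧ infDist y K < 4 * ε}).toReal := by
  set S := {y : EuclideanSpace ℝ (Fin 3) | dist y c ≤ R ∧ 0 < infDist y K ∧ infDist y K < 4 * ε}
    with hS
  have hSm : MeasurableSet S := measurableSet_annulus K c R ε
  have hSfin : volume S < ⊤ := volume_annulus_lt_top K c R ε
  have hb : Integrable (S.indicator fun _ => 4 * M * A) volume :=
    (integrableOn_const (hs := hSfin.ne)).integrable_indicator hSm
  have hpt : ∀ y, ‖g y * fderiv ℝ η y (G y)‖ ≤ S.indicator (fun _ => 4 * M * A) y := by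
    intro y
    by_cases hD : fderiv ℝ η y = 0
    · rw [hD]; simp only [_root_.zero_apply, mul_zero, norm_zero]
      exact Set.indicator_nonneg (fun _ _ => by positivity) y
    obtain ⟨⟨k₀, hk₀, hk₀d⟩, hall⟩ := h6 y hD
    by_cases hyc : R < dist y c
    · rw [hgR y hyc]; simp only [zero_mul, norm_zero]
      exact Set.indicator_nonneg (fun _ _ => by positivity) y
    rw [not_lt] at hyc
    have hKne : K.Nonempty := ⟨k₀, hk₀⟩
    have hin_lt : infDist y K < 4 * ε := lt_of_le_of_lt (infDist_le_dist_of_mem hk₀) hk₀d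
    have hin_pos : 0 < infDist y K :=
      lt_of_lt_of_le (by positivity : 0 < ε / 2) ((le_infDist hKne).2 fun k hk => (hall k hk).le)
    have hyS : y ∈ S := ⟨hyc, hin_pos, hin_lt⟩
    rw [Set.indicator_of_mem hyS, norm_mul, Real.norm_eq_abs]
    calc |g y| * ‖fderiv ℝ η y (G y)‖ ≤ 1 * (‖fderiv ℝ η y‖ * ‖G y‖) :=
          mul_le_mul (hg1 y) (ContinuousLinearMap.le_opNorm _ _) (norm_nonneg _) zero_le_one
      _ ≤ 1 * (M / ε * (A * (4 * ε))) := by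
          refine mul_le_mul_of_nonneg_left ?_ zero_le_one
          refine mul_le_mul (h5 y) ?_ (norm_nonneg _) (by positivity)
          exact (hGA y hyc).trans (mul_le_mul_of_nonneg_left hin_lt.le hA)
      _ = 4 * M * A := by field_simp
  have h := norm_integral_le_of_norm_le hb (Eventually.of_forall hpt)
  rw [integral_indicator_const _ hSm, smul_eq_mul, Real.norm_eq_abs] at h
  calc |∫ y, g y * fderiv ℝ η y (G y)| ≤ volume.real S * (4 * M * A) := h
    _ = 4 * M * A * (volume S).toReal := by rw [Measure.real, mul_comm]

/-- **The annular region is thin:** `vol {y ∈ closedBall c R | 0 < infDist y K < 4ε} → 0` as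
`ε → 0⁺` (decreasing sets with empty intersection and finite measure), in `ε`–`τ` form. -/
theorem exists_volume_annulus_le (K : Set (EuclideanSpace ℝ (Fin 3))) (c : EuclideanSpace ℝ (Fin 3))
    (R : ℝ) {τ : ℝ} (hτ : 0 < τ) :
    ∃ ε₁ : ℝ, 0 < ε₁ ∧ ∀ ε : ℝ, 0 < ε → ε ≤ ε₁ →
      (volume {y : EuclideanSpace ℝ (Fin 3) |
        dist y c ≤ R ∧ 0 < infDist y K ∧ infDist y K < 4 * ε}).toReal ≤ τ := by
  set s : ℕ → Set (EuclideanSpace ℝ (Fin 3)) := fun n =>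
    {y | dist y c ≤ R ∧ 0 < infDist y K ∧ infDist y K < 4 * (1 / ((n : ℝ) + 1))} with hs
  have hanti : Antitone s := by
    intro n m hnm y hy
    refine ⟨hy.1, hy.2.1, lt_of_lt_of_le hy.2.2 ?_⟩
    gcongr
  have hmeas : ∀ n, NullMeasurableSet (s n) volume := fun n =>
    (measurableSet_annulus K c R _).nullMeasurableSet
  have hfin : ∃ n, volume (s n) ≠ ⊤ := ⟨0, (volume_annulus_lt_top K c R _).ne⟩
  have hempty : ⋂ n, s n = ∅ := by
    ext y
    simp only [mem_iInter, mem_empty_iff_false, iff_false, not_forall]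
    by_cases hpos : 0 < infDist y K
    · obtain ⟨m, hm⟩ := exists_nat_one_div_lt (div_pos hpos (by norm_num : (0 : ℝ) < 4))
      exact ⟨m, fun h => by linarith [h.2.2]⟩
    · exact ⟨0, fun h => hpos h.2.1⟩
  have hlim := tendsto_measure_iInter_atTop hmeas hanti hfin
  rw [hempty, measure_empty] at hlim
  have hev : ∀ᶠ n in atTop, (volume ∘ s) n < ENNReal.ofReal τ :=
    (tendsto_order.1 hlim).2 _ (by simpa using hτ)
  obtain ⟨n, hn⟩ := hev.exists
  refine ⟨1 / ((n : ℝ) + 1), by positivity, fun ε hε hεn => ?_⟩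
  have hsub : {y : EuclideanSpace ℝ (Fin 3) | dist y c ≤ R ∧ 0 < infDist y K ∧ infDist y K < 4 * ε}
      ⊆ s n := fun y hy => ⟨hy.1, hy.2.1, lt_of_lt_of_le hy.2.2 (by gcongr)⟩
  exact ENNReal.toReal_le_of_le_ofReal hτ.le ((measure_mono hsub).trans (le_of_lt hn))

end AlignedStratum

end Summit.NavierStokesRegularity.NavierStokesRegularity.Theorems
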